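import Mathlib
import Literature.MathematicalPhysics.QuantumFieldTheory.Balaban1983to89.B16Ineq147Chain
import Literature.MathematicalPhysics.QuantumFieldTheory.Balaban1983to89.B11Ineq190Actual
import Literature.MathematicalPhysics.QuantumFieldTheory.Balaban1983to89.B15HDecayLeaves

/-!
# `Balaban1983to89.B16Ineq147FirstFrom190` — [Balaban1989LargeFieldII] (1.47) p. 368, THE FIRST «<» (the analytic leaf
`B16Ineq147Chain.Ineq147First`) DERIVED FROM [15] (190), and the whole display (1.47) BY NAME

T. Bałaban, *Large field renormalization. II. Localization, exponentiation, and bounds for the 𝐑 operation*, Commun. Math.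
Phys. **122** (1989) 355–392 [Balaban1989LargeFieldII] (cell paper B16; PDF held `paper:balaban1989-cmp122-large-field-ii`,
journal page = PDF page + 354; p. 368 = PDF 14, p. 367 = PDF 13 — text layer `p0013.txt`/`p0014.txt` read by this seat; the
display itself is garbled in the text layer and is taken LETTER FOR LETTER from r13 gen 12's typing `B16Ineq147Chain` §1, which
re-read the render `…-p014-x2.png` as an image), with T. Bałaban, *The variational problem and background fields in
renormalization group method for lattice gauge theories*, Commun. Math. Phys. **102** (1985) 277–309 [Balaban1985Variational],
Prop. 9 (190) pp. 308–309.

statement-level skeleton of published theorems with citation tags; proofs where landed; nothing here is a claim about the Yang–Mills mass gap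

CITATION HEADER / WHAT IS REPRODUCED.  Mega-formalization `lit-balaban`, HOME `run/shared/lean/pub/lit-balaban/`; Phase-2 proof seat
p29 gen 9 (unit `lit-balaban-p29`, free-target protocol G.5-34(d)).  SKELETON row **B16.Eq1.47** (owner r13; r13's
`SURVEY-B16-remaining.md` §B: *«What is left is ONLY the first "<" (decay of 𝐇″_{h+2}, Thm 1 [15]) — a leaf like (1.23)»*), whose
line 1 ⇒ line 2 ⇒ line 3 ⇒ (1.47) is PROVED in `B16Ineq147Chain` (r13 gen 12, p303925/p304321) from the typed leaf
`Ineq147First T B₃ δ C Linv B₅ M alpha gk C' N k h ε Γ dist := |T| < Σ_{j=1}^{h} Σ_{x∈Γ″_j} B₃e^{−δd(x,Ω″^{~2}_{h+1})}·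
(C L^{−N} B₃²B₅M⁶ alpha)·(g_k⁻² + C′(k − j))·ε_j`.
THE PRINT (p. 368, r13's verbatim transcription): *«The argument of the function 𝐇″_{h+2} has a support in the domain
Ω″^{~2}_{h+1} ∩ Z″_{h+2}. This is very important, because the exponential decay of this function suppresses strongly large values of
1/(g″_k(·))². … For example, consider the most dangerous term, the term linear in 𝐇″_{h+2}. It can be bounded in the following way:
|⟨D𝐇″_{h+2}, (1/(g″_k(·))²) ζ₁η⁻² Im ∂U″_{h+2}⟩| < Σ_{j=1}^{h} Σ_{x∈Γ″_j} B₃ exp(−δd(x, Ω″^{~2}_{h+1})) O(1) L^{−N} B₃²B₅M⁶(α_{0,k} +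
α_{1,k}) · (1/g_k² + O(k − j)) ε_j ≦ …»*; p. 367 foot: *«the function H_{k,Λ} in the representation (1.86) [IV] has the analytic
extension A₀ = … satisfying (1.87) [IV], with α_{0,k} + α_{1,k} instead of ε_k.»*

THE ROUTE (the same as `B16Ineq123From190`, p304610/p305232, for (1.23) p. 362).  The left member is the pairing, over the
generating set `{Γ″_j}` restricted to the scales `j = 1, …, h` where `ζ₁` lives, of the lattice field `D𝐇″_{h+2}(arg)` with
`J := (1/(g″_k(·))²) ζ₁η⁻² Im ∂U″_{h+2}`; it is typed as `T = Σ_{j=1}^{h} Σ_{x∈Γ″_j} s j x` with the pointwise pairing letter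
`|s j x| ≤ ‖(D𝐇″_{h+2}(arg))(x)‖·‖J_j(x)‖`.  The factor `B₃ exp(−δd(x, Ω″^{~2}_{h+1}))·(source size)` is the ONE-PIECE linear-response
bound of [15] Prop. 9: (190) at every base point for the size measuring `D𝐇` (r08's record `B11SectG.Ineq190`), the row sum (2.61),
and the mean-value domination `hmv` (`𝐇(0) = 0`; r12's `B15HDecayLeaves.loc_le_of_meanValue` BY NAME) give
`‖(D𝐇(arg))(x)‖ ≤ Cκ_Bc · m · e^{−τD(y(x))}` for an argument of B-size `≤ m` at every block vanishing on the blocks closer than `D(y)`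
to the block `y(x)` of `x`; print's source factor is the located size of the argument `R(e^{ig_kB})Q̃(ηA₀)`,
`m < C·L^{−N}B₃²B₅M⁶(α_{0,k} + α_{1,k})` ((1.87) [IV] with `α_{0,k} + α_{1,k}`, p. 367 foot — a hypothesis here, as the `11d²ε_h` of
(1.23) was), its support is *«Ω″^{~2}_{h+1} ∩ Z″_{h+2}»* (`hD`), the geometry letter is `δ·d(x, Ω″^{~2}_{h+1}) ≤ τ·D(y(x))`, and the
weight letter is `Cκ_Bc ≤ B₃`.  The J-side factor `(1/g_k² + O(k − j)) ε_j` is the located product of *«|1/(g″_k(x))²| ≤ g_k⁻² +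
O(1)(k − j)»* (running coupling on `Γ″_j`), `|ζ₁| ≤ 1` and the scale-`j` regularity `|η⁻² Im ∂U″_{h+2}(x)| ≤ ε_j` — ONE letter `hJ`
(with its sign letters).  The printed «<» is strict: it is obtained from the STRICT source bound on ONE non-empty `Γ″_j` (`hne`) —
for an empty double sum the typed strict inequality `|0| < 0` would be false, so `hne` is a genuine (harmless) hypothesis.

WHAT THIS FILE PROVES (kernel-checked, zero `sorry`, theorems only — no definition, no named fact; axioms standard).
§1 **`ineq147First_of_ineq190`** — `B16Ineq147Chain.Ineq147First T B₃ δ C Linv B₅ M alpha gk C' N k h ε Γ dist` AS TYPED for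
   `T = Σ_{j=1}^{h} Σ_{x∈Γ″_j} s j x`, over r12's abstract `BlockNorm` carriers, from the inputs just listed; `norm_lt_source_decay` —
   the per-point strict bound `‖(D𝐇(arg))(x)‖ < B₃e^{−δ·dist x}·S`.
§2 **`ineq147_of_ineq190`** — THE WHOLE DISPLAY: `B16Sect1Statements.Ineq147 T (C(1+C′)(1+β₀)²C_Γ·C_γ) A₀ C₁ B₃ B₅ M p₀g q₁g Rk
   Linv N` BY NAME, §1 fed to r13's `B16Ineq147Chain.ineq147_of_first` (its inputs verbatim: (2.8)[III] third member `hε`, `k = h + N`,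
   `N ≤ R_k`, the dictionary `alpha = C₁g_kq₁(g_k)`, `ε_k = g_kA₀p₀(g_k)`, the separation `hdist`, print's implicit double-sum count
   `hS` and the count `hΓ`).
§3 **`ineq147First_sectG`** — END TO END for ONE lattice presentation `ev : X → (𝒴 →L[ℝ] E)` (the values `(D𝐇)(x)`, compatibility
   letter `‖ev x v‖ ≤ bN.loc y v` on the box of `y`) of r08's (179)–(180) chart `B11Eq183Differentiation.chartH179 …`: (190) at every
   base point AND `hmv` at every block DISCHARGED by r08 g10's `B11Ineq190Actual.ineq190_and_hmv_supSize_sectG` (p304614); remaining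
   hypotheses = r08's located leaves of [15] Sect. G verbatim + one row sum + the [16]-side letters of §1.
HONEST SCOPE.  Located hypotheses, NOT discharged: (190) itself in §1/§2 (row B11.Eq190; in §3 what remains is r08's list — (189) is
author-omitted, G-B11-G2, and the words «Proposition 2 and (181)», G-B11-G2a, are not typed), the identification of `𝐇″_{h+2}` with a
(174)/(179) chart and of print's `D𝐇` with the presented values, the source size ((1.87) [IV] form) and support of the argument, the
J-side letters, the geometry/weight letters, `hne`.  Print attributes the decay to *«Thm 1 [15]»*/*«the exponential decay of the
H-function»*; the tree's kernel form of that decay for the LINEAR RESPONSE is Prop. 9 (190), used here exactly as in r12's B15 knits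
and in `B16Ineq123From190` — a reading, recorded, not a GAPS claim.  Nothing about `U″_{h+2}`, `ζ₁`, `g″_k(·)` is constructed.  NOT
summit progress.
-/

namespace Literature.MathematicalPhysics.QuantumFieldTheory.Balaban1983to89.B16Ineq147FirstFrom190

open Literature.MathematicalPhysics.QuantumFieldTheory.Balaban1983to89
open B11SectG B11SupSize190 B15HDecayLeaves B16Ineq147Chain Finset
open scoped NNReal

noncomputable section

/-! ## §1. Line 1 of (1.47) from the (190) record (abstract `BlockNorm` carriers) -/

section Abstract

variable {g : B6.Geometry} {FB FA : Type} [AddCommGroup FB] [Module ℝ FB] [AddCommGroup FA] [Module ℝ FA] {α : Type*}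

/-- **The per-point STRICT source-decay bound** behind line 1 of (1.47) (and behind (1.23)): with (190) at every base point for the
output size `bout` (constant `Cc`), (2.61) at rate `σ`, `τ ≥ 0`, `σ + τ ≤ ⅛δ₀`, the mean-value domination at the block `y`, an
argument `B` of B-size `< S` at every block and `= 0` on the blocks closer than `D` to `y`, `δ·dist ≤ τ·D` and `Cc·κ_B·c ≤ B₃`
(`B₃ > 0`), every quantity `nf ≤ bout.loc y 𝐇` satisfies `nf < B₃·e^{−δ·dist}·S`.
[cite: Balaban1989LargeFieldII, (1.47) p.368; Balaban1985Variational, Prop. 9 (190) pp.308–309] -/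
theorem norm_lt_source_decay {T : Type*} {bB : BlockNorm g FB} {bout : BlockNorm g FA} {dH : T → FB →ₗ[ℝ] FA}
    {Cc δ₀ σ τ c B₃ δ S D dist nf : ℝ}
    (h190 : ∀ t, Ineq190 bB bout (dH t) Cc δ₀) (hCc : 0 ≤ Cc) (hd : ∀ a b : g.Site, 0 ≤ g.dist a b) (hrow : RowSum g σ c)
    (hτ : 0 ≤ τ) (hστ : σ + τ ≤ δ₀ / 8) (B : FB) (y : g.Site) {HB : FA}
    (hmv : ∀ s : ℝ, (∀ t, bout.loc y (dH t B) ≤ s) → bout.loc y HB ≤ s)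
    (hm : ∀ y', bB.loc y' B < S) (hD : ∀ y', bB.loc y' B ≠ 0 → D ≤ g.dist y y')
    (hgeom : δ * dist ≤ τ * D) (hCB : Cc * bB.κ * c ≤ B₃) (hB₃ : 0 < B₃) (hdom : nf ≤ bout.loc y HB) :
    nf < B₃ * Real.exp (-(δ * dist)) * S := by
  classical
  haveI := g.fin
  -- the uniform B-size `m := max_{y′} loc y′ B < S`
  set m : ℝ := Finset.univ.sup' ⟨y, Finset.mem_univ y⟩ (fun y' => bB.loc y' B) with hm_def
  have hm_le : ∀ y', bB.loc y' B ≤ m := fun y' => Finset.le_sup' (fun y' => bB.loc y' B) (Finset.mem_univ y')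
  have hm_lt : m < S := (Finset.sup'_lt_iff _).mpr fun y' _ => hm y'
  have hm0 : 0 ≤ m := (bB.loc_nonneg y B).trans (hm_le y)
  have h1 := loc_le_of_meanValue h190 hCc hd hrow hτ hστ B hm_le y hD hmv
  have hexp : Real.exp (-(τ * D)) ≤ Real.exp (-(δ * dist)) := Real.exp_le_exp.mpr (by linarith)
  have hE : 0 < Real.exp (-(δ * dist)) := Real.exp_pos _
  have h2 : Cc * bB.κ * c * m * Real.exp (-(τ * D)) ≤ B₃ * m * Real.exp (-(δ * dist)) :=
    mul_le_mul (mul_le_mul_of_nonneg_right hCB hm0) hexp (Real.exp_pos _).le (by positivity)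
  have h3 : B₃ * m * Real.exp (-(δ * dist)) < B₃ * S * Real.exp (-(δ * dist)) :=
    mul_lt_mul_of_pos_right (mul_lt_mul_of_pos_left hm_lt hB₃) hE
  calc nf ≤ bout.loc y HB := hdom
    _ ≤ Cc * bB.κ * c * m * Real.exp (-(τ * D)) := h1
    _ ≤ B₃ * m * Real.exp (-(δ * dist)) := h2
    _ < B₃ * S * Real.exp (-(δ * dist)) := h3
    _ = B₃ * Real.exp (-(δ * dist)) * S := by ring

/-- **Line 1 of (1.47) p. 368 FROM [15] (190)** — r13's analytic leaf `B16Ineq147Chain.Ineq147First T B₃ δ C Linv B₅ M alpha gk C' N k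
h ε Γ dist` AS TYPED (strict), for the pairing decomposed along the generating set `T = Σ_{j=1}^{h} Σ_{x∈Γ″_j} s j x` with the
pointwise pairing letter `|s j x| ≤ nf x · nJ j x` (`nf x = ‖(D𝐇″_{h+2}(arg))(x)‖`, `nJ j x = ‖((1/g″_k²)ζ₁η⁻²Im ∂U″_{h+2})(x)‖`):
(190) at every base point for the size `bout` measuring `D𝐇″_{h+2}` (constant `Cc`), (2.61) `RowSum g σ c`, `τ ≥ 0`, `σ + τ ≤ ⅛δ₀`,
the mean-value domination at every block, the argument of B-size `< C·L^{−N}B₃²B₅M⁶(α_{0,k}+α_{1,k})` at every block (*«satisfying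
(1.87) [IV], with α_{0,k} + α_{1,k}»*) and `= 0` on the blocks `y′` with `d(y, y′) < D(y)` (*«support in the domain Ω″^{~2}_{h+1} ∩
Z″_{h+2}»*), the dictionary `nf x ≤ bout.loc (y j x) (D𝐇)`, the geometry `δ·d(x, Ω″^{~2}_{h+1}) ≤ τ·D(y j x)`, the weight
`Cc·κ_B·c ≤ B₃`, the J-side letters `0 ≤ nJ j x ≤ (g_k⁻² + C′(k − j))·ε_j` on `Γ″_j` with `(g_k⁻² + C′(k − j))·ε_j > 0` on the
non-empty `Γ″_j`, and ONE non-empty `Γ″_j`, `1 ≤ j ≤ h` (the printed «<» is strict).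
[cite: Balaban1989LargeFieldII, (1.47) p.368, p.367; Balaban1985Variational, Prop. 9 (190) pp.308–309] -/
theorem ineq147First_of_ineq190 {T : Type*} {bB : BlockNorm g FB} {bout : BlockNorm g FA} {dH : T → FB →ₗ[ℝ] FA}
    {Cc δ₀ σ τ c B₃ δ C Linv B₅ M alpha gk C' : ℝ} {N k h : ℕ} {ε : ℕ → ℝ} {Γ : ℕ → Finset α} {dist : α → ℝ}
    (h190 : ∀ t, Ineq190 bB bout (dH t) Cc δ₀) (hCc : 0 ≤ Cc) (hd : ∀ a b : g.Site, 0 ≤ g.dist a b) (hrow : RowSum g σ c)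
    (hτ : 0 ≤ τ) (hστ : σ + τ ≤ δ₀ / 8) (B : FB) {HB : FA}
    (hmv : ∀ (y : g.Site) (s : ℝ), (∀ t, bout.loc y (dH t B) ≤ s) → bout.loc y HB ≤ s)
    (hm : ∀ y', bB.loc y' B < C * Linv ^ N * B₃ ^ 2 * B₅ * M ^ 6 * alpha)
    {Dd : g.Site → ℝ} (hD : ∀ y y', bB.loc y' B ≠ 0 → Dd y ≤ g.dist y y')
    (hCB : Cc * bB.κ * c ≤ B₃) (hB₃ : 0 < B₃)
    {yOf : ℕ → α → g.Site} {nf : α → ℝ} {nJ s : ℕ → α → ℝ}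
    (hdom : ∀ j ∈ Icc 1 h, ∀ x ∈ Γ j, nf x ≤ bout.loc (yOf j x) HB)
    (hgeom : ∀ j ∈ Icc 1 h, ∀ x ∈ Γ j, δ * dist x ≤ τ * Dd (yOf j x))
    (hJ : ∀ j ∈ Icc 1 h, ∀ x ∈ Γ j, nJ j x ≤ ((gk ^ 2)⁻¹ + C' * ((k : ℝ) - j)) * ε j)
    (hJnn : ∀ j ∈ Icc 1 h, ∀ x ∈ Γ j, 0 ≤ nJ j x)
    (hJpos : ∀ j ∈ Icc 1 h, (Γ j).Nonempty → 0 < ((gk ^ 2)⁻¹ + C' * ((k : ℝ) - j)) * ε j)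
    (hpair : ∀ j ∈ Icc 1 h, ∀ x ∈ Γ j, |s j x| ≤ nf x * nJ j x)
    (hne : ∃ j ∈ Icc 1 h, (Γ j).Nonempty) {Tval : ℝ} (hT : Tval = ∑ j ∈ Icc 1 h, ∑ x ∈ Γ j, s j x) :
    Ineq147First Tval B₃ δ C Linv B₅ M alpha gk C' N k h ε Γ dist := by
  classical
  obtain ⟨j₀, hj₀, x₀, hx₀⟩ := hne
  set S : ℝ := C * Linv ^ N * B₃ ^ 2 * B₅ * M ^ 6 * alpha with hS_def
  have hS0 : 0 < S := (bB.loc_nonneg (yOf j₀ x₀) B).trans_lt (hm (yOf j₀ x₀))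
  -- per point: the strict source-decay bound
  have hpt : ∀ j ∈ Icc 1 h, ∀ x ∈ Γ j, nf x < B₃ * Real.exp (-(δ * dist x)) * S := fun j hj x hx =>
    norm_lt_source_decay h190 hCc hd hrow hτ hστ B (yOf j x) (hmv (yOf j x)) hm (hD (yOf j x)) (hgeom j hj x hx)
      hCB hB₃ (hdom j hj x hx)
  -- per summand: strict
  have hsum : ∀ j ∈ Icc 1 h, ∀ x ∈ Γ j, |s j x| < term147a B₃ δ C Linv B₅ M alpha gk C' N k ε dist j x := by
    intro j hj x hx
    have ha : 0 < B₃ * Real.exp (-(δ * dist x)) * S := by positivity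
    have hb : 0 < ((gk ^ 2)⁻¹ + C' * ((k : ℝ) - j)) * ε j := hJpos j hj ⟨x, hx⟩
    have hterm : term147a B₃ δ C Linv B₅ M alpha gk C' N k ε dist j x =
        (B₃ * Real.exp (-(δ * dist x)) * S) * (((gk ^ 2)⁻¹ + C' * ((k : ℝ) - j)) * ε j) := by
      simp only [term147a, hS_def]; ring
    rw [hterm]
    by_cases hJ0 : nJ j x = 0
    · have hs0 : |s j x| ≤ 0 := by simpa [hJ0] using hpair j hj x hx
      exact hs0.trans_lt (mul_pos ha hb)
    · have hJp : 0 < nJ j x := lt_of_le_of_ne (hJnn j hj x hx) (Ne.symm hJ0)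
      calc |s j x| ≤ nf x * nJ j x := hpair j hj x hx
        _ < (B₃ * Real.exp (-(δ * dist x)) * S) * nJ j x := mul_lt_mul_of_pos_right (hpt j hj x hx) hJp
        _ ≤ (B₃ * Real.exp (-(δ * dist x)) * S) * (((gk ^ 2)⁻¹ + C' * ((k : ℝ) - j)) * ε j) :=
            mul_le_mul_of_nonneg_left (hJ j hj x hx) ha.le
  -- sum
  unfold Ineq147First rhs147a
  rw [hT]
  calc |∑ j ∈ Icc 1 h, ∑ x ∈ Γ j, s j x| ≤ ∑ j ∈ Icc 1 h, |∑ x ∈ Γ j, s j x| := Finset.abs_sum_le_sum_abs _ _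
    _ ≤ ∑ j ∈ Icc 1 h, ∑ x ∈ Γ j, |s j x| := Finset.sum_le_sum fun j _ => Finset.abs_sum_le_sum_abs _ _
    _ < ∑ j ∈ Icc 1 h, ∑ x ∈ Γ j, term147a B₃ δ C Linv B₅ M alpha gk C' N k ε dist j x :=
        Finset.sum_lt_sum (fun j hj => Finset.sum_le_sum fun x hx => (hsum j hj x hx).le)
          ⟨j₀, hj₀, Finset.sum_lt_sum_of_nonempty ⟨x₀, hx₀⟩ fun x hx => hsum j₀ hj₀ x hx⟩

/-! ## §2. The whole display (1.47) by name -/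

/-- **(1.47) p. 368 FROM [15] (190)**: `B16Sect1Statements.Ineq147 T (C(1+C′)(1+β₀)²C_Γ·C_γ) A₀ C₁ B₃ B₅ M p₀g q₁g Rk Linv N`
BY NAME — §1's line 1 fed to r13's chain `B16Ineq147Chain.ineq147_of_first` (line 1 ⇒ 2 ⇒ 3 ⇒ (1.47)), whose inputs are carried
verbatim: the sign letters, `0 < g_k ≤ 1`, `0 ≤ β₀ ≤ 1`, `1 ≤ N`, `k = h + N`, the separation `d(x, Ω″^{~2}_{h+1}) ≥ M(h − j)` on
`Γ″_j`, the third member of (2.8) [III] `ε_j ≤ (1+β₀)²(k − j)^{β₀}ε_k`, the dictionary `alpha = C₁g_kq₁(g_k)`, `ε_k = g_kA₀p₀(g_k)`,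
`N ≤ R_k`, print's implicit double-sum count `hS` and the count `|Γ″_h ∩ Ω″^{~2}_{h+1}| ≤ C_γM⁴R_k⁵`.
[cite: Balaban1989LargeFieldII, (1.47) p.368; Balaban1985Variational, Prop. 9 (190) pp.308–309] -/
theorem ineq147_of_ineq190 {T : Type*} {bB : BlockNorm g FB} {bout : BlockNorm g FA} {dH : T → FB →ₗ[ℝ] FA}
    {Cc δ₀ σ τ c B₃ δ C Linv B₅ M alpha gk C' εk β₀ C₁ q₁g A₀ p₀g Rk CΓ cardΓ Cγ : ℝ} {N k h : ℕ} {ε : ℕ → ℝ}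
    {Γ : ℕ → Finset α} {dist : α → ℝ}
    (h190 : ∀ t, Ineq190 bB bout (dH t) Cc δ₀) (hCc : 0 ≤ Cc) (hd : ∀ a b : g.Site, 0 ≤ g.dist a b) (hrow : RowSum g σ c)
    (hτ : 0 ≤ τ) (hστ : σ + τ ≤ δ₀ / 8) (B : FB) {HB : FA}
    (hmv : ∀ (y : g.Site) (s : ℝ), (∀ t, bout.loc y (dH t B) ≤ s) → bout.loc y HB ≤ s)
    (hm : ∀ y', bB.loc y' B < C * Linv ^ N * B₃ ^ 2 * B₅ * M ^ 6 * alpha)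
    {Dd : g.Site → ℝ} (hD : ∀ y y', bB.loc y' B ≠ 0 → Dd y ≤ g.dist y y')
    (hCB : Cc * bB.κ * c ≤ B₃) (hB₃ : 0 < B₃)
    {yOf : ℕ → α → g.Site} {nf : α → ℝ} {nJ s : ℕ → α → ℝ}
    (hdom : ∀ j ∈ Icc 1 h, ∀ x ∈ Γ j, nf x ≤ bout.loc (yOf j x) HB)
    (hgeom : ∀ j ∈ Icc 1 h, ∀ x ∈ Γ j, δ * dist x ≤ τ * Dd (yOf j x))
    (hJ : ∀ j ∈ Icc 1 h, ∀ x ∈ Γ j, nJ j x ≤ ((gk ^ 2)⁻¹ + C' * ((k : ℝ) - j)) * ε j)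
    (hJnn : ∀ j ∈ Icc 1 h, ∀ x ∈ Γ j, 0 ≤ nJ j x)
    (hJpos : ∀ j ∈ Icc 1 h, (Γ j).Nonempty → 0 < ((gk ^ 2)⁻¹ + C' * ((k : ℝ) - j)) * ε j)
    (hpair : ∀ j ∈ Icc 1 h, ∀ x ∈ Γ j, |s j x| ≤ nf x * nJ j x)
    (hne : ∃ j ∈ Icc 1 h, (Γ j).Nonempty) {Tval : ℝ} (hT : Tval = ∑ j ∈ Icc 1 h, ∑ x ∈ Γ j, s j x)
    -- r13's chain inputs (line 1 ⇒ 2 ⇒ 3 ⇒ (1.47)), verbatim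
    (hC : 0 ≤ C) (hLinv : 0 ≤ Linv) (hB₅ : 0 ≤ B₅) (hα : 0 ≤ alpha)
    (hgk : 0 < gk) (hgk1 : gk ≤ 1) (hC' : 0 ≤ C') (hεk : 0 ≤ εk) (hδ : 0 ≤ δ) (hβ₀ : 0 ≤ β₀)
    (hβ₁ : β₀ ≤ 1) (hN : 1 ≤ N) (hk : k = h + N)
    (hdist : ∀ j ∈ Icc 1 h, ∀ x ∈ Γ j, M * ((h : ℝ) - j) ≤ dist x)
    (hε : ∀ j ∈ Icc 1 h, ε j ≤ (1 + β₀) ^ 2 * ((k : ℝ) - j) ^ β₀ * εk)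
    (hαeq : alpha = C₁ * gk * q₁g) (hεeq : εk = gk * A₀ * p₀g) (hNW : B16Sect1Kernels.NWindowUpper N Rk)
    (hCΓ : 0 ≤ CΓ) (hS : sum147b δ M β₀ h Γ dist ≤ CΓ * cardΓ) (hΓ : cardΓ ≤ Cγ * M ^ 4 * Rk ^ 5) :
    B16Sect1Statements.Ineq147 Tval ((C * (1 + C') * (1 + β₀) ^ 2 * CΓ) * Cγ) A₀ C₁ B₃ B₅ M p₀g q₁g Rk Linv N :=
  ineq147_of_first
    (ineq147First_of_ineq190 h190 hCc hd hrow hτ hστ B hmv hm hD hCB hB₃ hdom hgeom hJ hJnn hJpos hpair hne hT)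
    hB₃.le hC hLinv hB₅ hα hgk hgk1 hC' hεk hδ hβ₀ hβ₁ hN hk hdist hε hαeq hεeq hNW hCΓ hS hΓ

end Abstract

/-! ## §3. Line 1 of (1.47) END TO END from the located leaves of [15] Sect. G -/

section SectG

open B11Eq174Chart B11Eq183Differentiation B11Presentation190 B11Ineq190Actual B6RandomWalk

variable {𝒳 𝒴 𝒵 : Type} [NormedAddCommGroup 𝒳] [NormedSpace ℂ 𝒳] [NormedAddCommGroup 𝒴] [NormedSpace ℂ 𝒴]
  [NormedAddCommGroup 𝒵] [NormedSpace ℂ 𝒵] [CompleteSpace 𝒳] [CompleteSpace 𝒴] [CompleteSpace 𝒵]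
  {𝒢 : 𝒵 →L[ℂ] 𝒴} {W : 𝒴 → 𝒵} {D2 : 𝒴 →L[ℂ] 𝒵} {H₀ : 𝒳 →L[ℂ] 𝒴} {B₀ θ C₄ a₃ j a ε₄ : ℝ}
  {g : B6.Geometry} {X E : Type} [NormedAddCommGroup E] [NormedSpace ℝ E] {box : g.Site → Finset X}

/-- **Line 1 of (1.47) p. 368 END TO END FROM THE LOCATED LEAVES OF [15] SECT. G.**  For r08's (179)–(180) chart
`𝓗(B) = B11Eq183Differentiation.chartH179 𝒢 W D2 H₀ (· − H(D ·)) ε₄ B` and ONE lattice presentation `ev : X → (𝒴 →L[ℝ] E)` of the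
values `(D𝐇″_{h+2})(x)` (compatibility letter `‖ev x v‖ ≤ bN.loc y v` on the box of `y`; the points `x ∈ Γ″_j` lie in the boxes,
`x ∈ box (y j x)`), r13's leaf `Ineq147First (Σ_{j=1}^{h} Σ_{x∈Γ″_j} s j x) B₃ δ C Linv B₅ M alpha gk C' N k h ε Γ dist` with the
pairing letter `|s j x| ≤ ‖ev x (𝓗(B))‖ · nJ j x` holds — with (190) at every base point AND the mean-value domination at every block
DISCHARGED by r08 g10's `B11Ineq190Actual.ineq190_and_hmv_supSize_sectG`.  Hypotheses: r08's located leaves of Sect. G verbatim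
((189) `h189` on the domain, the kernel letters `hG`/`hD2H0`/`hH0`/`hH`, (73) `hDfr`, (2.54) `htri`, `q < 1`, `hN`/`hBloc`, the
scheme's `Regime` and analyticity letters, the domain condition on `B`), ONE row sum (2.61) `RowSum g σ c` with `τ ≥ 0`,
`σ + τ ≤ ⅛δ₀`, and the [16]-side letters of §1 with the weight against (190)'s constant `K = const190 …`.
[cite: Balaban1989LargeFieldII, (1.47) p.368; Balaban1985Variational, Prop. 9 (190) pp.308–309, (179)–(180) p.306] -/
theorem ineq147First_sectG (R : Regime 𝒢 0 W B₀ θ C₄ a₃ j a ε₄) (hWa : AnalyticOnNhd ℂ W {Y : 𝒴 | ‖Y‖ < a₃})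
    {D : 𝒴 → 𝒳} (H : 𝒳 →L[ℂ] 𝒴) (hTm : AnalyticOnNhd ℂ (fun Y : 𝒴 => Y - H (D Y)) {Y : 𝒴 | ‖Y‖ < ε₄ + a})
    (hTm0 : (0 : 𝒴) - H (D 0) = 0)
    {B : 𝒳} (hB : ‖H₀ B‖ < a ∧ ‖D2 (H₀ B)‖ < j)
    (ev : X → (𝒴 →L[ℝ] E))
    {bB : BlockNorm g 𝒳} {bN : BlockNorm g 𝒴} {b3 : BlockNorm g 𝒵}
    (hev : ∀ (y : g.Site) (v : 𝒴), ∀ x ∈ box y, ‖ev x v‖ ≤ bN.loc y v)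
    (hN : ∀ (y : g.Site) (v : 𝒴), bN.loc y v ≤ ‖v‖) (hBloc : ∀ (y' : g.Site) (μ : 𝒳), bB.IsLoc y' μ → ‖μ‖ ≤ bB.loc y' μ)
    {δ₀ BG θW cΔ A₀ AH θD c : ℝ}
    (htri : Triangle254 g) (hd : ∀ a b : g.Site, 0 ≤ g.dist a b) (hδ₀ : 0 ≤ δ₀)
    (hc : 0 ≤ c) (hBG : 0 ≤ BG) (hθW : 0 ≤ θW) (hcΔ : 0 ≤ cΔ) (hA₀ : 0 ≤ A₀) (hAH : 0 ≤ AH) (hθD : 0 ≤ θD)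
    (hG : HasMaj b3 bN (𝒢.restrictScalars ℝ : 𝒵 →ₗ[ℝ] 𝒴) (fun y y' => BG * Real.exp (-(δ₀ * g.dist y y'))))
    (hD2H0 : HasMaj bB b3 ((D2 ∘L H₀).restrictScalars ℝ : 𝒳 →ₗ[ℝ] 𝒵) (fun y y' => cΔ * Real.exp (-(δ₀ * g.dist y y'))))
    (hH0 : HasMaj bB bN (H₀.restrictScalars ℝ : 𝒳 →ₗ[ℝ] 𝒴) (fun y y' => A₀ * Real.exp (-(δ₀ * g.dist y y'))))
    (hH : HasMaj bB bN (H.restrictScalars ℝ : 𝒳 →ₗ[ℝ] 𝒴) (fun y y' => AH * Real.exp (-(δ₀ / 2 * g.dist y y'))))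
    (h189 : ∀ B' : 𝒳, ‖H₀ B'‖ < a → ‖D2 (H₀ B')‖ < j →
      Ineq189 bN b3 ((fderiv ℂ W (solA180 𝒢 W D2 H₀ ε₄ B' + H₀ B')).restrictScalars ℝ : 𝒴 →ₗ[ℝ] 𝒵) θW δ₀)
    (hDfr : ∀ B' : 𝒳, ‖H₀ B'‖ < a → ‖D2 (H₀ B')‖ < j →
      ∃ 𝔇 : 𝒴 →L[ℂ] 𝒳, HasFDerivAt D 𝔇 (solA180 𝒢 W D2 H₀ ε₄ B' + H₀ B') ∧
        HasMaj bN bB (𝔇.restrictScalars ℝ : 𝒴 →ₗ[ℝ] 𝒳) (fun y y' => θD * Real.exp (-(δ₀ / 2 * g.dist y y'))))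
    (hq : qG b3.κ bN.κ BG θW c < 1)
    -- the [16] side (§1's letters)
    {σ τ B₃ δ C Linv B₅ M alpha gk C' : ℝ} {N k h : ℕ} {ε : ℕ → ℝ} {Γ : ℕ → Finset X} {dist : X → ℝ}
    (hrow : RowSum g σ c) (hτ : 0 ≤ τ) (hστ : σ + τ ≤ δ₀ / 8)
    (hm : ∀ y', bB.loc y' B < C * Linv ^ N * B₃ ^ 2 * B₅ * M ^ 6 * alpha)
    {Dd : g.Site → ℝ} (hD : ∀ y y', bB.loc y' B ≠ 0 → Dd y ≤ g.dist y y')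
    (hCB : const190 bB.κ bN.κ b3.κ BG θW cΔ A₀ AH θD c * bB.κ * c ≤ B₃) (hB₃ : 0 < B₃)
    {yOf : ℕ → X → g.Site} {nJ s : ℕ → X → ℝ}
    (hx : ∀ j ∈ Icc 1 h, ∀ x ∈ Γ j, x ∈ box (yOf j x))
    (hgeom : ∀ j ∈ Icc 1 h, ∀ x ∈ Γ j, δ * dist x ≤ τ * Dd (yOf j x))
    (hJ : ∀ j ∈ Icc 1 h, ∀ x ∈ Γ j, nJ j x ≤ ((gk ^ 2)⁻¹ + C' * ((k : ℝ) - j)) * ε j)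
    (hJnn : ∀ j ∈ Icc 1 h, ∀ x ∈ Γ j, 0 ≤ nJ j x)
    (hJpos : ∀ j ∈ Icc 1 h, (Γ j).Nonempty → 0 < ((gk ^ 2)⁻¹ + C' * ((k : ℝ) - j)) * ε j)
    (hpair : ∀ j ∈ Icc 1 h, ∀ x ∈ Γ j,
      |s j x| ≤ ‖ev x (chartH179 𝒢 W D2 H₀ (fun Y : 𝒴 => Y - H (D Y)) ε₄ B)‖ * nJ j x)
    (hne : ∃ j ∈ Icc 1 h, (Γ j).Nonempty) :
    Ineq147First (∑ j ∈ Icc 1 h, ∑ x ∈ Γ j, s j x) B₃ δ C Linv B₅ M alpha gk C' N k h ε Γ dist := by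
  have hrow8 : RowSum g (δ₀ / 8) c := hrow.mono hd (by linarith)
  have hK : 0 ≤ const190 bB.κ bN.κ b3.κ BG θW cΔ A₀ AH θD c := by
    -- (= `B16Ineq123From190.const190_nonneg`, p305232; inlined to keep this file's imports to r08's record and r13's chain)
    have h₁ := constA0_nonneg (cΔ := cΔ) b3.κ_nonneg bN.κ_nonneg hBG hθW hcΔ hA₀ hc hq
    have h₂ := bB.κ_nonneg
    have h₃ := bN.κ_nonneg
    unfold const190
    positivity
  obtain ⟨j₀, hj₀, x₀, hx₀⟩ := hne
  -- r08's end-to-end pair at every block (the block assignment `blk` of the output sup size is immaterial: only `loc` enters)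
  have key := fun y : g.Site =>
    ineq190_and_hmv_supSize_sectG (box := box) (blk := fun _ => y) R hWa H hTm hTm0 hB ev hev hN hBloc htri
      hd hδ₀ hrow8 hc hBG hθW hcΔ hA₀ hAH hθD hG hD2H0 hH0 hH h189 hDfr hq
      (fun B' => fun x => ev x (chartH179 𝒢 W D2 H₀ (fun Y : 𝒴 => Y - H (D Y)) ε₄ B'))
      (fun t => (LinearMap.pi fun x => ((ev x : 𝒴 →L[ℝ] E) : 𝒴 →ₗ[ℝ] E)) ∘ₗ
        ((fderiv ℂ (chartH179 𝒢 W D2 H₀ (fun Y : 𝒴 => Y - H (D Y)) ε₄) ((t : ℝ) • B)).restrictScalars ℝ : 𝒳 →ₗ[ℝ] 𝒴))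
      (fun _ => rfl) (fun _ => rfl) y
  exact ineq147First_of_ineq190 (key (yOf j₀ x₀)).1 hK hd hrow hτ hστ B (fun y => (key y).2) hm hD hCB hB₃
    (fun j hj x hxΓ => norm_apply_le_loc (hx j hj x hxΓ)
      fun x => ev x (chartH179 𝒢 W D2 H₀ (fun Y : 𝒴 => Y - H (D Y)) ε₄ B))
    hgeom hJ hJnn hJpos hpair ⟨j₀, hj₀, x₀, hx₀⟩ rfl

end SectG

end

end Literature.MathematicalPhysics.QuantumFieldTheory.Balaban1983to89.B16Ineq147FirstFrom190
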